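import Summits.MatrixMultiplication.MatrixMultiplication.Theorems.FarEdgeDescentTowerBox
import HarnessLib

/-!
# Far-edge descent, kernel XXX-C2: `RateBeyond θ` from any certified box; the box `[0.1743, 0.1750]`

Route `FarEdgeDescent`, special leaf `FiniteSaturation` (stmt-MatrixMultiplication-23739): helper
kernel, THESES-FREE and def-free.  From the parametric core bound of kernel XXX-C1
(`FarEdgeDescentTowerBox.core_bound_of_cert`) this file derives, for EVERY certified box
`(J, α, β, lo)` of the clock-`7` full-class crude tower (`1 < lo ≤ 2`), the wedge
`s − 1 ≤ C·(1−t)^κ` on sub-tangents of `y ↦ ω(1,y,1)` with `κ = log₇ lo`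
(`virtualPowerBound_of_cert`), hence `e(x) = ω(1,x,1) − (x+1) ≤ C'·x^(−κ/(1−κ))` and
`RateBeyond θ` for all `θ < κ/(1−κ)` (`rateBeyond_of_cert`).  It then CERTIFIES the box
`[1743/10000, 175/1000]`, entered at stage `J = 18` (exact stage-`2` integers, then sixteen
outward-rounded `10⁻⁷` propagation steps), with multiplier `lo = 91/50`: order
`log₇1.82/(1 − log₇1.82) = 0.4445…`, certified floor `11/25` (`1.82^36 > 7^11`), i.e.
`RateBeyond θ` for every `θ ≤ 11/25` (`rateBeyond_of_le_eleven_twentyFifths`) — up from `21/50`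
(kernel XXX-B3, box `[0.172, 0.177]`, `lo = 1.79`).  The supremum of the method is `0.44861`
(`lo ↑ λ(m*) = 1.82689`, `m* = 0.17461…` the fixed point of `f`); any finer certified box plugs
into `rateBeyond_of_cert` verbatim.

References: Pan 1984 (LNCS 179) §17, Thm. 17.1; Lotti–Romani 1983, Thm. 3.1, Prop. 4.1;
Alman–Duan–Vassilevska Williams–Xu–Xu–Zhou 2025, §1 (rates of `ω(1,x,1) − (x+1)`).
Tags: `FiniteSaturation` (h₁) NEC · WEAKER (`RateBeyond θ`, `θ ≤ 11/25`, are theorems) ·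
a rate bound never implies (h₁) (saturation needs `e(k) = 0` at a finite `k`).
-/

set_option linter.dupNamespace false

noncomputable section

open scoped BigOperators

namespace Summit.MatrixMultiplication.MatrixMultiplication.Theorems.FarEdgeDescentTowerBoxRate

open Literature.Computability.AlgebraicComplexity
open Summit.MatrixMultiplication.MatrixMultiplication.Theorems.FarEdgeDescentTowerRatio
open Summit.MatrixMultiplication.MatrixMultiplication.Theorems.FarEdgeDescentTowerDeviation
open Summit.MatrixMultiplication.MatrixMultiplication.Theorems.FarEdgeDescentTowerBox

variable (K : Type) [Field K]

/-! ## §1 The wedge for a certified box -/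

/-- **Wedge from a certified box.**  If `(J, α, β, lo)` is a certified box of the clock-`7` crude
tower (`[α,β] ⊆ [4/25,19/100]`, `1 < lo ≤ 2`, `lo(1+φ(α)) ≤ 7(1−β)⁶`, and `m_j ∈ [α,β]` for all
`j ≥ J` along the chain of kernel XXX-A), then on every sub-tangent `(s,t)` of `y ↦ ω(1,y,1)`:
`s − 1 ≤ C·(1−t)^(log₇ lo)` with `C = 5·20^J·lo^(J+1)·(300·7^J/7)^(log₇ lo)`.
[cite: Pan1984, Thm. 17.1; LottiRomani1983, Thm. 3.1, Prop. 4.1] -/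
theorem virtualPowerBound_of_cert {α β lo : ℝ} (hα : (4 : ℝ) / 25 ≤ α) (hβ : β ≤ 19 / 100)
    (hlo1 : 1 < lo) (hlo2 : lo ≤ 2)
    (hloc : lo * (1 + ((1 - α) ^ 7 - (1 - 2 * α) ^ 7)) ≤ 7 * (1 - β) ^ 6) {J : ℕ}
    (hbox : ∀ r Q L : ℕ → ℕ, r 0 = 6 → Q 0 = 2 → L 0 = 2 →
      (∀ j, L (j + 1) = (Q j + L j) ^ 7 - Q j ^ 7) → (∀ j, r (j + 1) = r j ^ 7 + L (j + 1)) →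
      (∀ j, Q (j + 1) = r j ^ 7 - L (j + 1)) → (∀ j, 1 ≤ Q j) →
      (∀ j, (Q j + L j) ^ 7 ≤ r j ^ 7) →
      ∀ j, J ≤ j → α ≤ (L j : ℝ) / r j ∧ (L j : ℝ) / r j ≤ β) :
    ∃ C : ℝ, 0 ≤ C ∧ ∀ s t : ℝ, 0 ≤ t → t ≤ 1 → 1 ≤ s → s ≤ 2 →
      (∀ y : ℝ, 0 ≤ y → s + y * t ≤ omegaRect K 1 y 1) →
      s - 1 ≤ C * (1 - t) ^ Real.logb 7 lo := by
  obtain ⟨r, Q, L, G, h0r, h0Q, h0L, hG0, hL, hr, hQ, hG, hQ1, hall, hread⟩ :=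
    FarEdgeDescentTowerChain.crudeTowerChain_two K 7
  have hbx := hbox r Q L h0r h0Q h0L hL hr hQ hQ1 hall
  have hκ0 : 0 < Real.logb 7 lo := Real.logb_pos (by norm_num) hlo1
  have hlo0 : 0 ≤ lo := by linarith
  have h7J : (1 : ℝ) ≤ 7 ^ J := one_le_pow₀ (by norm_num)
  refine ⟨5 * 20 ^ J * lo ^ (J + 1) * (300 * 7 ^ J / 7 : ℝ) ^ Real.logb 7 lo, by positivity, ?_⟩
  intro s t ht0 ht1 hs1 hs2 hst
  have hu0 : 0 ≤ 1 - t := by linarith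
  -- the core bound in the form  s − 1 < A / lo^M
  have cv : ∀ M : ℕ, (1 - t) * (3 * 7 ^ (J + M)) ≤ 7 / 100 →
      s - 1 < 5 * 20 ^ J / lo ^ M := by
    intro M hM
    have h := core_bound_of_cert K r Q L G h0r h0Q h0L hG0 hL hr hQ hG hQ1 hall hread hα hβ
      hlo1.le hlo2 hloc hbx ht1 hs1 hst M hM
    have hlM : (0 : ℝ) < lo ^ M := by positivity
    have h20 : (0 : ℝ) < 20 ^ J := by positivity
    rw [lt_div_iff₀ hlM]
    rw [one_div_pow] at h
    have e : (1 : ℝ) / 20 ^ J * ((s - 1) / 5) * lo ^ M = (s - 1) * lo ^ M / (5 * 20 ^ J) := by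
      field_simp
    rw [e, div_lt_iff₀ (by positivity)] at h
    linarith
  have hA1 : (1 : ℝ) ≤ 5 * 20 ^ J * lo ^ (J + 1) := by
    have h1 : (1 : ℝ) ≤ 20 ^ J := one_le_pow₀ (by norm_num)
    have h2 : (1 : ℝ) ≤ lo ^ (J + 1) := one_le_pow₀ hlo1.le
    nlinarith
  by_cases hu : 1 - t = 0
  · -- t = 1: every M is admissible, so s − 1 ≤ 0
    have hv : s - 1 ≤ 0 := by
      by_contra hpos
      push Not at hpos
      obtain ⟨M, hM⟩ := pow_unbounded_of_one_lt (5 * 20 ^ J / (s - 1)) hlo1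
      have h := cv M (by rw [hu]; norm_num)
      rw [div_lt_iff₀ hpos] at hM
      rw [lt_div_iff₀ (by positivity)] at h
      linarith
    exact le_trans hv (by positivity)
  · have hupos : 0 < 1 - t := lt_of_le_of_ne hu0 (Ne.symm hu)
    by_cases hsmall : (1 - t) * (300 * 7 ^ J / 7) ≤ 1
    · -- X = 7/(300 u) ≥ 7^J, n = ⌊log₇ X⌋ ≥ J, M = n − J
      have hXpos : 0 < 7 / (300 * (1 - t)) := by positivity
      have hXJ : (7 : ℝ) ^ J ≤ 7 / (300 * (1 - t)) := by
        rw [le_div_iff₀ (by positivity)]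
        have : (1 - t) * (300 * 7 ^ J / 7) = 7 ^ J * (300 * (1 - t)) / 7 := by ring
        rw [this, div_le_iff₀ (by norm_num)] at hsmall
        linarith
      have hlJ : (J : ℝ) ≤ Real.logb 7 (7 / (300 * (1 - t))) := by
        rw [Real.le_logb_iff_rpow_le (by norm_num) hXpos, Real.rpow_natCast]
        exact hXJ
      have hnJ : J ≤ ⌊Real.logb 7 (7 / (300 * (1 - t)))⌋₊ := Nat.le_floor hlJ
      have hnle : (⌊Real.logb 7 (7 / (300 * (1 - t)))⌋₊ : ℝ) ≤ Real.logb 7 (7 / (300 * (1 - t))) :=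
        Nat.floor_le (by linarith [(Nat.cast_nonneg J : (0 : ℝ) ≤ J)])
      have hnlt := Nat.lt_floor_add_one (Real.logb 7 (7 / (300 * (1 - t))))
      have h7n : (7 : ℝ) ^ ⌊Real.logb 7 (7 / (300 * (1 - t)))⌋₊ ≤ 7 / (300 * (1 - t)) := by
        have := Real.rpow_le_rpow_of_exponent_le (by norm_num : (1 : ℝ) ≤ 7) hnle
        rwa [Real.rpow_natCast, Real.rpow_logb (by norm_num) (by norm_num) hXpos] at this
      have hM : (1 - t) * (3 * 7 ^ (J + (⌊Real.logb 7 (7 / (300 * (1 - t)))⌋₊ - J))) ≤ 7 / 100 := by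
        rw [Nat.add_sub_cancel' hnJ]
        calc (1 - t) * (3 * 7 ^ ⌊Real.logb 7 (7 / (300 * (1 - t)))⌋₊)
            ≤ (1 - t) * (3 * (7 / (300 * (1 - t)))) := by gcongr
          _ = 7 / 100 := by field_simp; norm_num
      have hv := cv _ hM
      -- compare lo^(n-J) with lo^(log₇ X − (J+1)) = X^κ / lo^(J+1)
      have e1 : lo ^ (Real.logb 7 (7 / (300 * (1 - t))) - (J + 1)) ≤
          lo ^ (⌊Real.logb 7 (7 / (300 * (1 - t)))⌋₊ - J) := by
        have h := Real.rpow_le_rpow_of_exponent_le hlo1.le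
          (show Real.logb 7 (7 / (300 * (1 - t))) - (J + 1) ≤
            ((⌊Real.logb 7 (7 / (300 * (1 - t)))⌋₊ - J : ℕ) : ℝ) by
              push_cast [Nat.cast_sub hnJ]; linarith)
        rwa [Real.rpow_natCast] at h
      have e2 : lo ^ (Real.logb 7 (7 / (300 * (1 - t))) - (J + 1)) =
          (7 / (300 * (1 - t))) ^ Real.logb 7 lo / lo ^ (J + 1) := by
        rw [Real.rpow_sub (by linarith), show ((J : ℝ) + 1) = ((J + 1 : ℕ) : ℝ) by push_cast; ring,
          Real.rpow_natCast]
        congr 1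
        rw [Real.rpow_def_of_pos (by linarith), Real.rpow_def_of_pos hXpos, Real.logb, Real.logb]
        congr 1
        have h7 : Real.log 7 ≠ 0 := Real.log_ne_zero_of_pos_of_ne_one (by norm_num) (by norm_num)
        field_simp
      have e3 : (7 / (300 * (1 - t))) ^ Real.logb 7 lo =
          ((300 * (1 - t) / 7) ^ Real.logb 7 lo)⁻¹ := by
        rw [← Real.inv_rpow (by positivity)]
        congr 1
        field_simp
      have hXκ : 0 < (300 * (1 - t) / 7) ^ Real.logb 7 lo := by positivity
      have e4 : (300 * (1 - t) / 7) ^ Real.logb 7 lo ≤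
          (300 * 7 ^ J / 7 : ℝ) ^ Real.logb 7 lo * (1 - t) ^ Real.logb 7 lo := by
        rw [← Real.mul_rpow (by positivity) hu0]
        apply Real.rpow_le_rpow (by positivity) _ hκ0.le
        have : 300 * (1 - t) / 7 = 300 * 1 / 7 * (1 - t) := by ring
        rw [this]
        apply mul_le_mul_of_nonneg_right _ hu0
        gcongr
      -- assemble
      have hlpow : (0 : ℝ) < lo ^ (⌊Real.logb 7 (7 / (300 * (1 - t)))⌋₊ - J) := by positivity
      have step1 : 5 * 20 ^ J / lo ^ (⌊Real.logb 7 (7 / (300 * (1 - t)))⌋₊ - J) ≤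
          5 * 20 ^ J / (lo ^ (Real.logb 7 (7 / (300 * (1 - t))) - (J + 1))) :=
        div_le_div_of_nonneg_left (by positivity) (by rw [e2, e3]; positivity) e1
      rw [e2, e3] at step1
      have hlJ1 : (0 : ℝ) < lo ^ (J + 1) := by positivity
      have step2 : 5 * 20 ^ J / (((300 * (1 - t) / 7) ^ Real.logb 7 lo)⁻¹ / lo ^ (J + 1)) =
          5 * 20 ^ J * lo ^ (J + 1) * (300 * (1 - t) / 7) ^ Real.logb 7 lo := by
        field_simp
      rw [step2] at step1
      have step3 : 5 * 20 ^ J * lo ^ (J + 1) * (300 * (1 - t) / 7) ^ Real.logb 7 lo ≤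
          5 * 20 ^ J * lo ^ (J + 1) *
            ((300 * 7 ^ J / 7 : ℝ) ^ Real.logb 7 lo * (1 - t) ^ Real.logb 7 lo) :=
        mul_le_mul_of_nonneg_left e4 (by positivity)
      linarith
    · -- u large: s − 1 ≤ 1 ≤ (300·7^J/7·u)^κ
      push Not at hsmall
      have h1 : (1 : ℝ) ≤ (300 * 7 ^ J / 7 * (1 - t)) ^ Real.logb 7 lo :=
        Real.one_le_rpow (by linarith) hκ0.le
      rw [Real.mul_rpow (by positivity) hu0] at h1
      have hv1 : s - 1 ≤ 1 := by linarith
      nlinarith [mul_le_mul hA1 h1 (by norm_num) (by positivity)]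

/-! ## §2 Rates from a certified box -/

/-- **Rate from a certified box**: `e(x) ≤ C'·x^(−κ/(1−κ))`, `κ = log₇ lo`, for all `x > 0`.
[cite: Pan1984, Thm. 17.1; LottiRomani1983, Prop. 4.1] -/
theorem excess_le_rpow_of_cert {α β lo : ℝ} (hα : (4 : ℝ) / 25 ≤ α) (hβ : β ≤ 19 / 100)
    (hlo1 : 1 < lo) (hlo2 : lo ≤ 2)
    (hloc : lo * (1 + ((1 - α) ^ 7 - (1 - 2 * α) ^ 7)) ≤ 7 * (1 - β) ^ 6) {J : ℕ}
    (hbox : ∀ r Q L : ℕ → ℕ, r 0 = 6 → Q 0 = 2 → L 0 = 2 →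
      (∀ j, L (j + 1) = (Q j + L j) ^ 7 - Q j ^ 7) → (∀ j, r (j + 1) = r j ^ 7 + L (j + 1)) →
      (∀ j, Q (j + 1) = r j ^ 7 - L (j + 1)) → (∀ j, 1 ≤ Q j) →
      (∀ j, (Q j + L j) ^ 7 ≤ r j ^ 7) →
      ∀ j, J ≤ j → α ≤ (L j : ℝ) / r j ∧ (L j : ℝ) / r j ≤ β) :
    ∃ C : ℝ, ∀ x : ℝ, 0 < x → omegaRect K 1 x 1 - (x + 1) ≤
      C * x ^ (-(Real.logb 7 lo / (1 - Real.logb 7 lo))) := by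
  obtain ⟨C, hC, hV⟩ := virtualPowerBound_of_cert K hα hβ hlo1 hlo2 hloc hbox
  have hκ0 : 0 < Real.logb 7 lo := Real.logb_pos (by norm_num) hlo1
  have hκ1 : Real.logb 7 lo < 1 := by
    have h := Real.logb_lt_logb (b := 7) (by norm_num) (by linarith : (0 : ℝ) < lo)
      (by linarith : lo < 7)
    rwa [Real.logb_self_eq_one (by norm_num)] at h
  exact ⟨_, fun x hx => FarEdgeDescentVirtualPoint.excess_le_const_mul_rpow_of_virtualPowerBound K
    hC hκ0 hκ1 hV hx⟩

/-- **`RateBeyond θ` from a certified box**, for every `θ < κ/(1−κ)`, `κ = log₇ lo`, in the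
route's `RateBeyond` shape `∃ δ > θ, ∃ C, ∀ k ≥ 1, e(k) ≤ C·k^(−δ)`.
[cite: LottiRomani1983, Prop. 4.1; Pan1984, Thm. 17.1] -/
theorem rateBeyond_of_cert {α β lo : ℝ} (hα : (4 : ℝ) / 25 ≤ α) (hβ : β ≤ 19 / 100)
    (hlo1 : 1 < lo) (hlo2 : lo ≤ 2)
    (hloc : lo * (1 + ((1 - α) ^ 7 - (1 - 2 * α) ^ 7)) ≤ 7 * (1 - β) ^ 6) {J : ℕ}
    (hbox : ∀ r Q L : ℕ → ℕ, r 0 = 6 → Q 0 = 2 → L 0 = 2 →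
      (∀ j, L (j + 1) = (Q j + L j) ^ 7 - Q j ^ 7) → (∀ j, r (j + 1) = r j ^ 7 + L (j + 1)) →
      (∀ j, Q (j + 1) = r j ^ 7 - L (j + 1)) → (∀ j, 1 ≤ Q j) →
      (∀ j, (Q j + L j) ^ 7 ≤ r j ^ 7) →
      ∀ j, J ≤ j → α ≤ (L j : ℝ) / r j ∧ (L j : ℝ) / r j ≤ β)
    {θ : ℝ} (hθ : θ < Real.logb 7 lo / (1 - Real.logb 7 lo)) :
    ∃ δ C : ℝ, θ < δ ∧ ∀ k : ℕ, 1 ≤ k →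
      omegaRect K 1 k 1 - (k + 1) ≤ C * (k : ℝ) ^ (-δ) := by
  obtain ⟨C, hC⟩ := excess_le_rpow_of_cert K hα hβ hlo1 hlo2 hloc hbox
  refine ⟨_, C, hθ, fun k hk => ?_⟩
  have hkpos : (0 : ℝ) < k := by exact_mod_cast hk
  exact hC k hkpos

/-! ## §3 The certified box `[1743/10000, 175/1000]` at stage `18`, multiplier `91/50` -/

section Chain

variable (r Q L : ℕ → ℕ)

/-- **Certified orbit to stage 18.**  For the chain of kernel XXX-A (clock `7`, `r₀ = 6`, `Q₀ = 2`,
`L₀ = 2`): `m_j = L_j/r_j ∈ [1743/10000, 175/1000]` for every `j ≥ 18` (exact stage-`2`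
integers, sixteen outward-rounded `10⁻⁷` steps, then `f`-invariance of the box). [folklore] -/
theorem ratio_mem_sharpBox
    (h0r : r 0 = 6) (h0Q : Q 0 = 2) (h0L : L 0 = 2)
    (hL : ∀ j, L (j + 1) = (Q j + L j) ^ 7 - Q j ^ 7) (hr : ∀ j, r (j + 1) = r j ^ 7 + L (j + 1))
    (hQ : ∀ j, Q (j + 1) = r j ^ 7 - L (j + 1)) (hQ1 : ∀ j, 1 ≤ Q j)
    (hall : ∀ j, (Q j + L j) ^ 7 ≤ r j ^ 7) :
    ∀ j, 18 ≤ j → (1743 : ℝ) / 10000 ≤ (L j : ℝ) / r j ∧ (L j : ℝ) / r j ≤ 175 / 1000 := by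
  have h0 : Q 0 + 2 * L 0 = r 0 := by rw [h0Q, h0L, h0r]
  have hsum := anchor_add_two_mul_legs r Q L hL hr hQ hall h0
  have hrec := ratio_succ r Q L hL hr hQ1 hsum
  have hL1 : L 1 = 16256 := by rw [hL 0, h0Q, h0L]; norm_num
  have hr1 : r 1 = 296192 := by rw [hr 0, h0r, hL1]; norm_num
  have hQ1' : Q 1 = 263680 := by rw [hQ 0, h0r, hL1]; norm_num
  have hL2 : L 2 = 46091794531484846221836184574436048896 := by
    rw [hL 1, hQ1', hL1]; norm_num
  have hr2 : r 2 = 246084092155603549010846855071315001344 := by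
    rw [hr 1, hr1, hL2]; norm_num
  have I2 : (187300 : ℝ) / 1000000 ≤ (L 2 : ℝ) / r 2 ∧ (L 2 : ℝ) / r 2 ≤ 187301 / 1000000 := by
    rw [hL2, hr2]
    push_cast
    constructor
    · rw [le_div_iff₀ (by norm_num)]; norm_num
    · rw [div_le_iff₀ (by norm_num)]; norm_num
  have I3 := ratio_step_mem (α' := 1643953 / 10000000) (β' := 1643962 / 10000000) (by norm_num)
    (by norm_num) I2 (hrec 2)
    (by rw [le_div_iff₀ (by norm_num)]; norm_num) (by rw [div_le_iff₀ (by norm_num)]; norm_num)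
  have I4 := ratio_step_mem (α' := 1823866 / 10000000) (β' := 1823874 / 10000000) (by norm_num)
    (by norm_num) I3 (hrec 3)
    (by rw [le_div_iff₀ (by norm_num)]; norm_num) (by rw [div_le_iff₀ (by norm_num)]; norm_num)
  have I5 := ratio_step_mem (α' := 1684093 / 10000000) (β' := 1684101 / 10000000) (by norm_num)
    (by norm_num) I4 (hrec 4)
    (by rw [le_div_iff₀ (by norm_num)]; norm_num) (by rw [div_le_iff₀ (by norm_num)]; norm_num)
  have I6 := ratio_step_mem (α' := 1793874 / 10000000) (β' := 1793881 / 10000000) (by norm_num)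
    (by norm_num) I5 (hrec 5)
    (by rw [le_div_iff₀ (by norm_num)]; norm_num) (by rw [div_le_iff₀ (by norm_num)]; norm_num)
  have I7 := ratio_step_mem (α' := 1708249 / 10000000) (β' := 1708256 / 10000000) (by norm_num)
    (by norm_num) I6 (hrec 6)
    (by rw [le_div_iff₀ (by norm_num)]; norm_num) (by rw [div_le_iff₀ (by norm_num)]; norm_num)
  have I8 := ratio_step_mem (α' := 1775458 / 10000000) (β' := 1775465 / 10000000) (by norm_num)
    (by norm_num) I7 (hrec 7)
    (by rw [le_div_iff₀ (by norm_num)]; norm_num) (by rw [div_le_iff₀ (by norm_num)]; norm_num)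
  have I9 := ratio_step_mem (α' := 1722935 / 10000000) (β' := 1722942 / 10000000) (by norm_num)
    (by norm_num) I8 (hrec 8)
    (by rw [le_div_iff₀ (by norm_num)]; norm_num) (by rw [div_le_iff₀ (by norm_num)]; norm_num)
  have I10 := ratio_step_mem (α' := 1764136 / 10000000) (β' := 1764143 / 10000000) (by norm_num)
    (by norm_num) I9 (hrec 9)
    (by rw [le_div_iff₀ (by norm_num)]; norm_num) (by rw [div_le_iff₀ (by norm_num)]; norm_num)
  have I11 := ratio_step_mem (α' := 1731905 / 10000000) (β' := 1731912 / 10000000) (by norm_num)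
    (by norm_num) I10 (hrec 10)
    (by rw [le_div_iff₀ (by norm_num)]; norm_num) (by rw [div_le_iff₀ (by norm_num)]; norm_num)
  have I12 := ratio_step_mem (α' := 1757176 / 10000000) (β' := 1757183 / 10000000) (by norm_num)
    (by norm_num) I11 (hrec 11)
    (by rw [le_div_iff₀ (by norm_num)]; norm_num) (by rw [div_le_iff₀ (by norm_num)]; norm_num)
  have I13 := ratio_step_mem (α' := 1737396 / 10000000) (β' := 1737402 / 10000000) (by norm_num)
    (by norm_num) I12 (hrec 12)
    (by rw [le_div_iff₀ (by norm_num)]; norm_num) (by rw [div_le_iff₀ (by norm_num)]; norm_num)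
  have I14 := ratio_step_mem (α' := 1752900 / 10000000) (β' := 1752906 / 10000000) (by norm_num)
    (by norm_num) I13 (hrec 13)
    (by rw [le_div_iff₀ (by norm_num)]; norm_num) (by rw [div_le_iff₀ (by norm_num)]; norm_num)
  have I15 := ratio_step_mem (α' := 1740761 / 10000000) (β' := 1740767 / 10000000) (by norm_num)
    (by norm_num) I14 (hrec 14)
    (by rw [le_div_iff₀ (by norm_num)]; norm_num) (by rw [div_le_iff₀ (by norm_num)]; norm_num)
  have I16 := ratio_step_mem (α' := 1750274 / 10000000) (β' := 1750279 / 10000000) (by norm_num)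
    (by norm_num) I15 (hrec 15)
    (by rw [le_div_iff₀ (by norm_num)]; norm_num) (by rw [div_le_iff₀ (by norm_num)]; norm_num)
  have I17 := ratio_step_mem (α' := 1742824 / 10000000) (β' := 1742829 / 10000000) (by norm_num)
    (by norm_num) I16 (hrec 16)
    (by rw [le_div_iff₀ (by norm_num)]; norm_num) (by rw [div_le_iff₀ (by norm_num)]; norm_num)
  have I18 := ratio_step_mem (α' := 1748662 / 10000000) (β' := 1748667 / 10000000) (by norm_num)
    (by norm_num) I17 (hrec 17)
    (by rw [le_div_iff₀ (by norm_num)]; norm_num) (by rw [div_le_iff₀ (by norm_num)]; norm_num)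
  refine ratio_mem_box_of_cert r Q L hL hr hQ1 hsum (by norm_num) (by norm_num) (by norm_num)
    (by norm_num) ⟨by linarith [I18.1], by linarith [I18.2]⟩

end Chain

/-- `11/25 < κ/(1−κ)` for `κ = log₇(91/50)` (`1.82^36 > 7^11` gives `κ > 11/36`); the exact
order of this box is `0.4445…`. [folklore] -/
theorem sharpOrder_gt :
    (11 : ℝ) / 25 < Real.logb 7 ((91 : ℝ) / 50) / (1 - Real.logb 7 ((91 : ℝ) / 50)) := by
  have h1 : Real.log ((7 : ℝ) ^ 11) < Real.log (((91 : ℝ) / 50) ^ 36) :=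
    Real.log_lt_log (by positivity) (by norm_num)
  rw [Real.log_pow, Real.log_pow] at h1
  push_cast at h1
  have h7 : 0 < Real.log 7 := Real.log_pos (by norm_num)
  have hκ : (11 : ℝ) / 36 < Real.logb 7 ((91 : ℝ) / 50) := by
    rw [Real.logb, lt_div_iff₀ h7]
    linarith
  have hκ1 : Real.logb 7 ((91 : ℝ) / 50) < 1 := by
    have h := Real.logb_lt_logb (b := 7) (by norm_num) (by norm_num : (0 : ℝ) < 91 / 50)
      (by norm_num : (91 : ℝ) / 50 < 7)
    rwa [Real.logb_self_eq_one (by norm_num)] at h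
  rw [lt_div_iff₀ (by linarith)]
  linarith

/-- **`RateBeyond θ` for every `θ < log₇1.82/(1 − log₇1.82) = 0.4445…`** (every field), from the
certified box `[0.1743, 0.175]`, `J = 18`, `lo = 91/50`. [cite: LottiRomani1983, Prop. 4.1;
Pan1984, Thm. 17.1] -/
theorem rateBeyond_of_lt_sharpOrder {θ : ℝ}
    (hθ : θ < Real.logb 7 ((91 : ℝ) / 50) / (1 - Real.logb 7 ((91 : ℝ) / 50))) :
    ∃ δ C : ℝ, θ < δ ∧ ∀ k : ℕ, 1 ≤ k →
      omegaRect K 1 k 1 - (k + 1) ≤ C * (k : ℝ) ^ (-δ) :=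
  rateBeyond_of_cert K (α := 1743 / 10000) (β := 175 / 1000) (J := 18) (by norm_num) (by norm_num)
    (by norm_num) (by norm_num) (by norm_num)
    (fun r Q L h0r h0Q h0L hL hr hQ hQ1 hall => ratio_mem_sharpBox r Q L h0r h0Q h0L hL hr hQ hQ1 hall)
    hθ

/-- **`RateBeyond θ` for every `θ ≤ 11/25`** (every field) — up from `21/50` (kernel XXX-B3).
[cite: LottiRomani1983, Prop. 4.1; Pan1984, Thm. 17.1] -/
theorem rateBeyond_of_le_eleven_twentyFifths {θ : ℝ} (hθ : θ ≤ 11 / 25) :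
    ∃ δ C : ℝ, θ < δ ∧ ∀ k : ℕ, 1 ≤ k →
      omegaRect K 1 k 1 - (k + 1) ≤ C * (k : ℝ) ^ (-δ) :=
  rateBeyond_of_lt_sharpOrder K (lt_of_le_of_lt hθ sharpOrder_gt)

end Summit.MatrixMultiplication.MatrixMultiplication.Theorems.FarEdgeDescentTowerBoxRate

end
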